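import Literature.NumberTheory.EllipticCurves.BinaryQuarticMinimisationProofs
import Literature.NumberTheory.EllipticCurves.BhargavaShankarSelmerFrontierProofs
import Literature.NumberTheory.EllipticCurves.BhargavaShankarEq31FrontierProofs
import HarnessLib

/-!
# Bhargava–Shankar, Theorem 5.6 (the `2`-Selmer parametrization) discharged; Theorem 1.1 and
# Cor. 1.2 granted eq. (31) alone

`Proofs` companion (theorems only: no definitions, no named facts) of `BinaryQuarticForms.lean`
(the named fact `Literature.NumberTheory.EllipticCurves.bhargavaShankar_card_selmerTwo_eq`,
Thm 5.6 of the held arXiv text `arXiv:1006.1002v2` = Thm 3.5 of the published version) and of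
`BSDSelmer.lean` (`Literature.NumberTheory.EllipticCurves.average_card_selmerTwo`, Thm 1.1).
Source: M. Bhargava, A. Shankar, *Binary quartic forms having bounded invariants, and the
boundedness of the average rank of elliptic curves*, Ann. of Math. (2) 181 (2015) 191–242.

## What is proved (one-line assemblies of results already in the tree)

* `bhargavaShankar_card_selmerTwo_eq_holds` — **Theorem 5.6 is now a theorem**: the
  Birch–Swinnerton-Dyer correspondence (Lemma 5.2,
  `bhargavaShankar_card_selmerTwo_eq_kEquivClassCount_holds`, `BinaryQuarticMinimisationProofs`)
  composed with the minimisation Lemmas 5.3–5.5 (`bsd_minimisation_*_holds`) through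
  `bhargavaShankar_card_selmerTwo_eq_of_bsd_correspondence` (`BinaryQuarticMinimisationTwoProofs`).
* `average_card_selmerTwo_of_eq31`, `heightAverageLE_card_selmerTwo_of_eq31`,
  `averageRankLE_three_halves_of_eq31` — **Theorem 1.1 (average `#S₂ = 3`), its `limsup` form, and
  Cor. 1.2 (average rank `≤ 3/2`) follow from the single remaining named input**
  `bhargavaShankar_sum_irredClassCount_asymptotic` (display (31) of the held text with Prop. 5.12
  and Lemma 5.16 folded in = the first display of the proof of Thm 3.19 of the published version):
  Thm 5.6 (this file), Props. 5.7–5.8, Lemma 5.15, Lemma 5.16 and the assembly of §5.4 being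
  theorems of the tree (`BhargavaShankarTwoTorsionProofs`, `BhargavaShankarCountingProofs`,
  `PadicPointsFiniteIndexProofs`). By `BhargavaShankarSieveStepEquivProofs`, eq. (31) is in turn
  equivalent, granted Thm 2.1 (`bhargavaShankar_classCount`), to the sieve step (†)
  (`bhargavaShankar_locSolIrredClassCount_asymptotic`).

## Remark on the remaining input (for the record; nothing below is used in this file)

Eq. (31) concerns `N(S^F; Y)`, a count of `PGL₂(ℚ)`-classes. In the published proof the
unweighted class counts of Thm 2.1 are obtained from the lattice-point counts of §2.3 (which weigh
a `GL₂(ℤ)`-orbit by `1/#Stab`) through Lemma 2.4 (orbits with stabilizer of size `> 2` in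
`GL₂(ℚ)` are `O(X^{3/4+ε})`), whose published proof (§2.8) rests on [Bhargava, Ann. of Math. 162
(2005), proof of Lemma 12] and Prop. 2.16. For the classes counted in eq. (31) — locally soluble
forms whose invariants come from a curve `E_{A,B}` — a nontrivial stabilizer in `PGL₂(ℚ)` means
`E_{A,B}(ℚ)[2] ≠ 0` (Thm 3.2 of the published version; tree: `BinaryQuarticStabilizerTorsion`,
`BhargavaShankarFieldParametrization`), and the `2`-Selmer elements of all such curves of height
`< X` number `O(X^{3/4+ε})` by the tree's proof of Prop. 5.8
(`bhargavaShankar_sum_card_selmerTwo_twoTorsion_le_holds`, via the `2`-descent bound rather than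
Lemma 3.21). Hence eq. (31) may be derived from the *weighted* (by `1/#Stab_{GL₂(ℤ)}`) versions of
Thm 2.1 and of the sieve, without Lemma 2.4.

## References

* M. Bhargava, A. Shankar, Ann. of Math. (2) 181 (2015) 191–242 = arXiv:1006.1002; Thm 5.6,
  Thm 1.1, Cor. 1.2, §5.4 display (31) (arXiv v2 numbering); Thm 3.5, Thm 3.19, Lemma 2.4 and §2.8
  (published numbering). [cite: BhargavaShankarAnnals2015, Thm 5.6 and Thm 1.1 (arXiv:1006.1002v2 numbering)]
-/

noncomputable section

namespace Literature.NumberTheory.EllipticCurves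

/-- **Bhargava–Shankar, Theorem 5.6 (the `2`-Selmer parametrization), discharged**: for
`E = E_{A,B}` in the height family, `#S₂(E)` equals the number of `PGL₂(ℚ)`-classes of locally
soluble integral binary quartic forms with invariants `2⁴I(E)`, `2⁶J(E)` — Lemma 5.2 (the
Birch–Swinnerton-Dyer correspondence, `bhargavaShankar_card_selmerTwo_eq_kEquivClassCount_holds`)
and Lemmas 5.3–5.5 (minimisation at `p ≥ 5`, `3`, `2`), all theorems of the tree.
[cite: BhargavaShankarAnnals2015, Thm 5.6 (arXiv:1006.1002v2 numbering; = Thm 3.5 of the published version)] -/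
theorem bhargavaShankar_card_selmerTwo_eq_holds : bhargavaShankar_card_selmerTwo_eq :=
  bhargavaShankar_card_selmerTwo_eq_of_bsd_correspondence
    bhargavaShankar_card_selmerTwo_eq_kEquivClassCount_holds

/-- **Bhargava–Shankar, Theorem 1.1, granted eq. (31) alone**: when all elliptic curves `E/ℚ` are
ordered by height, the average size of the `2`-Selmer group is `3`
(`Literature.NumberTheory.EllipticCurves.average_card_selmerTwo`), from the single named input
`bhargavaShankar_sum_irredClassCount_asymptotic`; Thm 5.6, Props. 5.7–5.8, Lemmas 5.15–5.16 and
§5.4 are theorems of the tree. [cite: BhargavaShankarAnnals2015, Thm 1.1] -/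
theorem average_card_selmerTwo_of_eq31 (h31 : bhargavaShankar_sum_irredClassCount_asymptotic) :
    average_card_selmerTwo :=
  average_card_selmerTwo_of_two_BS_facts bhargavaShankar_card_selmerTwo_eq_holds h31

/-- **Bhargava–Shankar, Theorem 1.1 in `limsup` form, granted eq. (31) alone**
(`Literature.NumberTheory.EllipticCurves.heightAverageLE_card_selmerTwo`).
[cite: BhargavaShankarAnnals2015, Thm 1.1] -/
theorem heightAverageLE_card_selmerTwo_of_eq31
    (h31 : bhargavaShankar_sum_irredClassCount_asymptotic) :
    heightAverageLE_card_selmerTwo :=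
  heightAverageLE_card_selmerTwo_of_two_BS_facts bhargavaShankar_card_selmerTwo_eq_holds h31

/-- **Bhargava–Shankar, Cor. 1.2 (average rank `≤ 3/2`), granted eq. (31) alone**
(`Literature.NumberTheory.EllipticCurves.averageRankLE_three_halves`).
[cite: BhargavaShankarAnnals2015, Cor. 1.2] -/
theorem averageRankLE_three_halves_of_eq31
    (h31 : bhargavaShankar_sum_irredClassCount_asymptotic) :
    averageRankLE_three_halves :=
  averageRankLE_three_halves_of_two_BS_facts bhargavaShankar_card_selmerTwo_eq_holds h31

/-- **Theorem 1.1 granted the sieve step (†) and Thm 2.1** (the two named inputs of eq. (31),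
`BhargavaShankarEq31FrontierProofs`), Thm 5.6 being discharged.
[cite: BhargavaShankarAnnals2015, Thm 1.1] -/
theorem average_card_selmerTwo_of_sieve_of_classCount
    (hG : bhargavaShankar_locSolIrredClassCount_asymptotic) (h16 : bhargavaShankar_classCount) :
    average_card_selmerTwo :=
  average_card_selmerTwo_of_eq31 (bhargavaShankar_sum_irredClassCount_asymptotic_of_two_facts hG h16)

end Literature.NumberTheory.EllipticCurves

end
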